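import Summits.QuantumFields.YangMills.Theorems.BalabanLadderNTMarkovMirrorBare
import Summits.QuantumFields.YangMills.Theorems.PencilRigidityCurvatureKernelBoundOddTorusCovCauchySchwarz
import HarnessLib

/-!
# Crux `UVSeamRec` (stmt-QuantumFields-20043), stub `stub_floorsEngine` (S-B) / crux `NT` clause (i):
# the converse — a `Q2(θv, v)` floor forces the bare mirror floor (modulo the chirality defect)

Helper file (`--supports stmt-QuantumFields-20043`) of the seam stub-prover row `ym-20043-seam-s1` (owner RULING R75),
sequel of `…NTMarkovMirrorBare`.  There, the clause-(i) package of the Markov–mirror line was reduced to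
{RBLΔ, MF}: the chirality-defect response bound and the bare mirror floor `4ε ≤ Cov_T(Ṽ_v∘Θ₀, Ṽ_v)` of the smeared
action density carried by one positive-time cube, which give `ε ≤ Q2(θv, v)` (`Q2_floor_of_bareFloor_chiral`).  This
file closes the circle at fixed coupling and torus: under the SAME (RBLΔ) (error `√ε/2`), a floor `ε ≤ Q2(θv, v)` forces
`ε/2 ≤ Cov_T(Ṽ_v∘Θ₀, Ṽ_v)` (`bareFloor_of_Q2_floor`).  Mechanism: the exact chirality identity
`Q2(θv, v) = Cov_T(Wᴿ∘Θ₀, Ṽ)` (p508701), the mirror forms (p506289), the split `B(m_R, m) = B(m, m) + B(D, m)` with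
`sup |D| ≤ √ε/2`, reflection-positivity Cauchy–Schwarz `B(D, m)² ≤ B(D, D)·B(m, m)` AND reflection positivity
`B(m, m) ≥ 0` on the odd torus (tree `CurvatureKernel.OddTorusCovCauchySchwarz`), and the scalar lemma
`bare_floor_arith` (`ε ≤ X + B(D,m)`, `B(D,D) ≤ ε/4`, `X ≥ 0` ⇒ `X ≥ ε/2`; the sharp constant is `(9 − √17)/8`).

Upshot (located reading for the owner's pen; no registry content): modulo (RBLΔ) — an `O(aβ)` one-point statement
implied by `FBL6` (p510874) — the Markov–mirror clause-(i) package with EXISTENTIAL shell data {RBL+SUP, SF}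
(p512282's hypothesis), the bare mirror floor (MF), and the clause-(i) floor `Q2(θv, v) ≥ ε` for the same `v` on the
same cube family are mutually equivalent up to absolute constants (`4 ↔ 9/4 ↔ 1 ↔ 1/2`), coupling by coupling and
torus by torus.  The one-point data of card E therefore carry content beyond clause (i) only once the shell functional
`𝒢` is PINNED (the card's classical Dirichlet-excess functional) — as a proof strategy for (MF), not as a weaker target.

* §1 `dependsOn_strictHalf_of_posHalf` — the closed non-negative half in the two coordinate descriptions of the tree;
* §2 `bare_floor_arith`;
* §3 `bareFloor_of_Q2_floor` (per coupling `β ≥ 0` and odd torus), `bareFloors_of_Q2_floors` (along a unit map).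

Honest status: bookkeeping only; (MF)/(RBLΔ)/clause (ii) remain engine-grade (crux `NT`).  Refs: Osterwalder–Seiler
1978 §2; Fröhlich–Israel–Lieb–Simon 1978 Thm 2.1; card `Cruxes/NT/Ideas/markov-mirror-dirichlet-response.md`.
-/

set_option autoImplicit false

noncomputable section

open scoped SchwartzMap
open MeasureTheory Filter Topology
open Literature.MathematicalPhysics.QuantumFieldTheory Literature.MathematicalPhysics.QuantumLattice
open Literature.Probability.LatticeModels
open Literature.MathematicalPhysics.QuantumFieldTheory.WilsonRP (shift_apply_self)
open Summit.QuantumFields.YangMills.Cruxes.OSLegsFromFemtoAndGap.DlrCollarTransfer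
open Summit.QuantumFields.YangMills.Cruxes.OSLegsFromFemtoAndGap.DlrCollarTransfer.StubLower (mem_cubeSites_iff)
open Summit.QuantumFields.YangMills.Cruxes.NT.Reference (continuous_kerE continuous_kerE_torusLift)
open Summit.QuantumFields.YangMills.Cruxes.NT.BoundaryLaw (abs_kerE_le)
open Summit.QuantumFields.YangMills.Cruxes.NT.Reflection (sq_cov_negReflect_le_odd_pos integrable_wilson_of_bdd)
open Summit.QuantumFields.YangMills.Theorems.CurvatureKernel (OddTorusCovCauchySchwarz)

namespace Summit.QuantumFields.YangMills.Cruxes.NT.MarkovMirror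

/-! ## §1 The closed non-negative half of the odd torus, two descriptions -/

section Half

variable {G : Type}

/-- On the torus of side `2L+1` (`L ≥ 1`), an observable of the links with both endpoints at times `≤ L` is an
observable of the links based at times `≤ L` whose temporal members are based at times `< L` (the description used by
`CurvatureKernel.OddTorusCovCauchySchwarz`): the former link set is contained in the latter. [folklore] -/
theorem dependsOn_strictHalf_of_posHalf {L : ℕ} (hL1 : 1 ≤ L) {α : Type*} {F : GaugeConfig 4 (2 * L + 1) G → α}
    (hF : DependsOn F {e : Edge 4 (2 * L + 1) | (e.1 0).val ≤ L ∧ ((e.1.shift e.2) 0).val ≤ L}) :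
    DependsOn F {e : Edge 4 (2 * L + 1) | (e.1 0).val ≤ L ∧ (e.2 = 0 → (e.1 0).val < L)} := by
  refine fun U V hUV => hF fun e he => hUV e ?_
  obtain ⟨he1, he2⟩ := he
  refine ⟨he1, fun hi => ?_⟩
  obtain ⟨x, i⟩ := e
  simp only at he1 he2 hi ⊢
  subst hi
  by_contra hlt
  have heq : (x 0).val = L := le_antisymm he1 (not_lt.1 hlt)
  haveI : Fact (1 < 2 * L + 1) := ⟨by omega⟩
  have hval : ((x.shift 0) 0).val = (x 0).val + 1 := by
    rw [shift_apply_self, ZMod.val_add, ZMod.val_one, Nat.mod_eq_of_lt (by omega)]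
  omega

end Half

/-! ## §2 The scalar step -/

/-- **Scalar step of the converse.**  If `ε ≤ X + m`, `m² ≤ d·X`, `d ≤ ε/4`, `0 ≤ X`, `0 < ε`, then `ε/2 ≤ X`
(indeed `X ≥ (9 − √17)ε/8`): otherwise `m ≥ ε − X > ε/2` and `(ε − X)² ≤ m² ≤ εX/4`, i.e.
`X² − (9/4)εX + ε² ≤ 0`, impossible for `X < ε/2`. [folklore] -/
theorem bare_floor_arith {X bdm bdd ε : ℝ} (hε : 0 < ε) (hX0 : 0 ≤ X) (hQ : ε ≤ X + bdm)
    (hcs : bdm ^ 2 ≤ bdd * X) (hdd : bdd ≤ ε / 4) : ε / 2 ≤ X := by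
  by_contra h
  have h' : X < ε / 2 := not_le.1 h
  have h1 : ε - X ≤ bdm := by linarith
  have h3 : (ε - X) ^ 2 ≤ bdm ^ 2 := by
    have h5 : 0 ≤ bdm - (ε - X) := by linarith
    have h6 : 0 ≤ bdm + (ε - X) := by linarith
    nlinarith [mul_nonneg h5 h6]
  have h4 : bdd * X ≤ ε / 4 * X := mul_le_mul_of_nonneg_right hdd hX0
  have h7 : 0 < (ε / 2 - X) * (7 * ε / 4 - X) := mul_pos (by linarith) (by linarith)
  nlinarith [h3, hcs, h4, h7, hε]

/-! ## §3 A `Q2(θv, v)` floor forces the bare mirror floor -/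

section Converse

variable (G : Type) [Group G] [TopologicalSpace G] [IsTopologicalGroup G] [CompactSpace G]
  [MeasurableSpace G] [BorelSpace G] (r : LatticeRep G)

/-- **Converse of the chiral mirror floor (fixed `β ≥ 0`, torus `2L+1`).**  A cube `Q = (c, b)` at times `≥ 1` with
its closed collar inside the window; a spacing `s` and a test function `v` whose lattice support `{x : v(s·x) ≠ 0}` lies
in `Q` at depth `≥ 2`; `Ṽ = ∑_y v(s·y) dens_y`, `Wᴿ` the reflected-species smearing; (RBLΔ)
`|kerE_Q^ζ(Wᴿ) − kerE_Q^ζ(Ṽ) − p'| ≤ √ε/2` for every exterior `ζ`; and a floor `ε ≤ Q2 G r β L s (θv) v`, `0 < ε`.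
Then `ε/2 ≤ Cov_T(Ṽ∘Θ₀, Ṽ)` (read through the periodic lift). [folklore] -/
theorem bareFloor_of_Q2_floor {β : ℝ} (hβ : 0 ≤ β) (c : Fin 4 → ℤ) (b L : ℕ) (hc0 : 1 ≤ c 0)
    (hcL : c 0 + (b : ℤ) + 3 ≤ L) (hc : ∀ j, -(L : ℤ) + 2 ≤ c j ∧ c j + (b : ℤ) + 2 ≤ (L : ℤ) + 1)
    (s : ℝ) (v : 𝓢(EuclideanSpace ℝ (Fin 4), ℝ))
    (hsupp : ∀ x : Fin 4 → ℤ, v (s • siteToE x) ≠ 0 → x ∈ cubeSites c b ∧ 2 ≤ depth c b x)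
    {p' ε : ℝ} (hε : 0 < ε)
    (hΔ : ∀ ζ, |kerE G r β c b ζ (fun V => ∑ x ∈ cubeSites c b, v (s • siteToE x) *
        ∑ q : {q : Fin 4 × Fin 4 // q.1 < q.2}, plane G r q.1 (if q.1.1 = 0 then x - Pi.single 0 1 else x) V) -
      kerE G r β c b ζ (fun V => ∑ y ∈ cubeSites c b, v (s • siteToE y) * dens G r y V) - p'| ≤ Real.sqrt ε / 2)
    (hQ : ε ≤ Q2 G r β L s (thetaTest 4 v) v) :
    ε / 2 ≤ torusE G r β L (fun V => (∑ y ∈ cubeSites c b, v (s • siteToE y) * dens G r y (cfgReflect V)) *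
          ∑ y ∈ cubeSites c b, v (s • siteToE y) * dens G r y V) -
      torusE G r β L (fun V => ∑ y ∈ cubeSites c b, v (s • siteToE y) * dens G r y (cfgReflect V)) *
        torusE G r β L (fun V => ∑ y ∈ cubeSites c b, v (s • siteToE y) * dens G r y V) := by
  classical
  haveI := r.secondCountableTopology
  haveI := isProbabilityMeasure_wilsonMeasure (d := 4) (L := 2 * L + 1) r.ρ r.continuous β
  -- the two cube-carried observables
  set W : LGConfig 4 G → ℝ := fun V => ∑ y ∈ cubeSites c b, v (s • siteToE y) * dens G r y V with hW
  set WR : LGConfig 4 G → ℝ := fun V => ∑ x ∈ cubeSites c b, v (s • siteToE x) *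
    ∑ q : {q : Fin 4 × Fin 4 // q.1 < q.2}, plane G r q.1 (if q.1.1 = 0 then x - Pi.single 0 1 else x) V with hWR
  have hWc : Continuous W := continuous_cubeSmear G r c b _
  obtain ⟨MW, hMW⟩ := exists_abs_cubeSmear_le G r c b (fun y => v (s • siteToE y))
  obtain ⟨SW, hWS, hSW⟩ := exists_isCylinder_cubeSmear G r c b (fun y => v (s • siteToE y))
  have hWRc : Continuous WR := continuous_reflSmear G r _ _
  obtain ⟨MR, hMR⟩ := exists_abs_reflSmear_le G r (cubeSites c b) (fun x => v (s • siteToE x))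
  obtain ⟨SR, hRS, hSR⟩ := exists_isCylinder_reflSmear G r c b (fun x => v (s • siteToE x))
    fun x _ hx => (hsupp x hx).2
  -- the cube sits in the box
  have hsub : cubeSites c b ⊆ box 4 L := fun y hy => by
    rw [mem_box]
    intro j
    have h := (mem_cubeSites_iff _ _ _).1 hy j
    have := hc j
    constructor <;> linarith [h.1, h.2]
  -- (1) `Q2 = Cov_T(Wᴿ∘Θ₀, Ṽ)`
  have hQ2 := Q2_thetaTest_eq_torusCov_reflSmear G r β L s v c b hsub fun x hx => (hsupp x hx).1
  -- (2) mirror factorisations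
  have hfacR := torusCov_reflect_lift_eq_torusCov_reflect_kerE G r β c b L hc0 hcL hc hWRc hWc hMR hMW hRS hWS hSR hSW
  have hfacW := torusCov_reflect_lift_eq_torusCov_reflect_kerE G r β c b L hc0 hcL hc hWc hWc hMW hMW hWS hWS hSW hSW
  -- torus observables
  set m : GaugeConfig 4 (2 * L + 1) G → ℝ := fun U => kerE G r β c b (torusLift (2 * L + 1) U) W with hm
  set mR : GaugeConfig 4 (2 * L + 1) G → ℝ := fun U => kerE G r β c b (torusLift (2 * L + 1) U) WR with hmR
  set D : GaugeConfig 4 (2 * L + 1) G → ℝ := fun U => mR U - m U - p' with hD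
  have hmc : Continuous m := continuous_kerE_torusLift G r β c b (2 * L + 1) hWc hMW
  have hmb : ∀ U, |m U| ≤ MW := fun U => abs_kerE_le G r β c b _ hMW
  have hmRc : Continuous mR := continuous_kerE_torusLift G r β c b (2 * L + 1) hWRc hMR
  have hDc : Continuous D := (hmRc.sub hmc).sub continuous_const
  have hDb : ∀ U, |D U| ≤ Real.sqrt ε / 2 := fun U => hΔ _
  -- non-negative-half dependence
  have hposm : DependsOn m {e : Edge 4 (2 * L + 1) | (e.1 0).val ≤ L ∧ ((e.1.shift e.2) 0).val ≤ L} :=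
    dependsOn_posHalf_of_window L (isCylinder_kerE G r β c b hWc.measurable hWS) fun e he => by
      have := kerE_supp_window hSW he 0
      constructor <;> linarith [this.1, this.2]
  have hposR : DependsOn mR {e : Edge 4 (2 * L + 1) | (e.1 0).val ≤ L ∧ ((e.1.shift e.2) 0).val ≤ L} :=
    dependsOn_posHalf_of_window L (isCylinder_kerE G r β c b hWRc.measurable hRS) fun e he => by
      have := kerE_supp_window hSR he 0
      constructor <;> linarith [this.1, this.2]
  have hposD : DependsOn D {e : Edge 4 (2 * L + 1) | (e.1 0).val ≤ L ∧ ((e.1.shift e.2) 0).val ≤ L} :=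
    fun U V hUV => by simp only [hD, hposm hUV, hposR hUV]
  have hL1 : 1 ≤ L := by linarith
  -- (3) reflection-positivity Cauchy–Schwarz for `(D, m)`, the sup bound on `B(D, D)`, positivity of `B(m, m)`
  have hcs := sq_cov_negReflect_le_odd_pos (d := 4) (L := 2 * L + 1) r.ρ rfl hL1 r.continuous hβ
    hDc.measurable hmc.measurable ⟨Real.sqrt ε / 2, hDb⟩ ⟨MW, hmb⟩ hposD hposm
  have hdd := mirrorForm_le_sq (T := 2 * L + 1) r.ρ r.continuous β hDc.measurable hDb
  have hdd' : (∫ U, D U.negReflect * D U ∂(wilsonMeasure (d := 4) (L := 2 * L + 1) r.ρ β)) -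
      (∫ U, D U ∂(wilsonMeasure (d := 4) (L := 2 * L + 1) r.ρ β)) ^ 2 ≤ ε / 4 := by
    rw [div_pow, Real.sq_sqrt hε.le] at hdd
    linarith
  have hX0 : 0 ≤ (∫ U, m U.negReflect * m U ∂(wilsonMeasure (d := 4) (L := 2 * L + 1) r.ρ β)) -
      (∫ U, m U ∂(wilsonMeasure (d := 4) (L := 2 * L + 1) r.ρ β)) ^ 2 := by
    have h := (OddTorusCovCauchySchwarz G r.N r.ρ r.continuous β hβ L hL1 m m hmc.measurable hmc.measurable
      ⟨MW, hmb⟩ ⟨MW, hmb⟩ (dependsOn_strictHalf_of_posHalf hL1 hposm) (dependsOn_strictHalf_of_posHalf hL1 hposm)).1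
    rw [← sq] at h
    exact h
  -- integrability and invariance bookkeeping
  have hϑ : Measurable (GaugeConfig.negReflect : GaugeConfig 4 (2 * L + 1) G → GaugeConfig 4 (2 * L + 1) G) :=
    WilsonSiteRP.measurable_negReflect
  have im : Integrable m (wilsonMeasure (d := 4) (L := 2 * L + 1) r.ρ β) :=
    integrable_wilson_of_bdd r.ρ r.continuous β hmc.measurable ⟨MW, hmb⟩
  have iD : Integrable D (wilsonMeasure (d := 4) (L := 2 * L + 1) r.ρ β) :=
    integrable_wilson_of_bdd r.ρ r.continuous β hDc.measurable ⟨Real.sqrt ε / 2, hDb⟩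
  have imm : Integrable (fun U => m U.negReflect * m U) (wilsonMeasure (d := 4) (L := 2 * L + 1) r.ρ β) :=
    integrable_wilson_of_bdd r.ρ r.continuous β ((hmc.measurable.comp hϑ).mul hmc.measurable) ⟨MW * MW, fun U => by
      rw [abs_mul]; exact mul_le_mul (hmb _) (hmb _) (abs_nonneg _) ((abs_nonneg _).trans (hmb U))⟩
  have iDm : Integrable (fun U => D U.negReflect * m U) (wilsonMeasure (d := 4) (L := 2 * L + 1) r.ρ β) :=
    integrable_wilson_of_bdd r.ρ r.continuous β ((hDc.measurable.comp hϑ).mul hmc.measurable)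
      ⟨Real.sqrt ε / 2 * MW, fun U => by
        rw [abs_mul]
        exact mul_le_mul (hDb _) (hmb _) (abs_nonneg _) ((abs_nonneg _).trans (hDb (U.negReflect)))⟩
  have hinvR : ∫ U, mR U.negReflect ∂(wilsonMeasure (d := 4) (L := 2 * L + 1) r.ρ β) =
      ∫ U, mR U ∂(wilsonMeasure (d := 4) (L := 2 * L + 1) r.ρ β) :=
    integral_comp_negReflect_eq (d := 4) (L := 2 * L + 1) r.ρ r.continuous β mR
  have hinvm : ∫ U, m U.negReflect ∂(wilsonMeasure (d := 4) (L := 2 * L + 1) r.ρ β) =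
      ∫ U, m U ∂(wilsonMeasure (d := 4) (L := 2 * L + 1) r.ρ β) :=
    integral_comp_negReflect_eq (d := 4) (L := 2 * L + 1) r.ρ r.continuous β m
  -- (4) `B(m_R, m) = B(m, m) + B(D, m)`
  have emR : ∀ U, mR U = m U + D U + p' := fun U => by simp only [hD]; ring
  have hsplit : (∫ U, mR U.negReflect * m U ∂(wilsonMeasure (d := 4) (L := 2 * L + 1) r.ρ β)) -
      (∫ U, mR U ∂(wilsonMeasure (d := 4) (L := 2 * L + 1) r.ρ β)) *
        (∫ U, m U ∂(wilsonMeasure (d := 4) (L := 2 * L + 1) r.ρ β)) =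
      ((∫ U, m U.negReflect * m U ∂(wilsonMeasure (d := 4) (L := 2 * L + 1) r.ρ β)) -
        (∫ U, m U ∂(wilsonMeasure (d := 4) (L := 2 * L + 1) r.ρ β)) ^ 2) +
      ((∫ U, D U.negReflect * m U ∂(wilsonMeasure (d := 4) (L := 2 * L + 1) r.ρ β)) -
        (∫ U, D U ∂(wilsonMeasure (d := 4) (L := 2 * L + 1) r.ρ β)) *
          (∫ U, m U ∂(wilsonMeasure (d := 4) (L := 2 * L + 1) r.ρ β))) := by
    have e1 : (fun U => mR U.negReflect * m U) =
        fun U => (m U.negReflect * m U + D U.negReflect * m U) + p' * m U := by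
      funext U; rw [emR]; ring
    have e2 : (fun U => mR U) = fun U => (m U + D U) + p' := by funext U; rw [emR]
    have i1 : Integrable (fun U => m U.negReflect * m U + D U.negReflect * m U)
        (wilsonMeasure (d := 4) (L := 2 * L + 1) r.ρ β) := imm.add iDm
    have i2 : Integrable (fun U => p' * m U) (wilsonMeasure (d := 4) (L := 2 * L + 1) r.ρ β) := im.const_mul p'
    have i3 : Integrable (fun U => m U + D U) (wilsonMeasure (d := 4) (L := 2 * L + 1) r.ρ β) := im.add iD
    rw [e1, integral_add i1 i2, integral_add imm iDm, integral_const_mul]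
    rw [show (∫ U, mR U ∂(wilsonMeasure (d := 4) (L := 2 * L + 1) r.ρ β)) =
        ∫ U, (fun U => (m U + D U) + p') U ∂(wilsonMeasure (d := 4) (L := 2 * L + 1) r.ρ β) by rw [← e2],
      integral_add i3 (integrable_const _), integral_add im iD, integral_const, smul_eq_mul, probReal_univ]
    ring
  -- assemble: the floor on `Q2` in `B`-coordinates
  rw [hQ2, hfacR] at hQ
  unfold torusE at hfacW hQ ⊢
  simp only [← torusLift_negReflect] at hfacW hQ ⊢
  change ε ≤ (∫ U, mR U.negReflect * m U ∂(wilsonMeasure (d := 4) (L := 2 * L + 1) r.ρ β)) -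
    (∫ U, mR U.negReflect ∂(wilsonMeasure (d := 4) (L := 2 * L + 1) r.ρ β)) *
      (∫ U, m U ∂(wilsonMeasure (d := 4) (L := 2 * L + 1) r.ρ β)) at hQ
  rw [hinvR, hsplit] at hQ
  -- the goal in `B`-coordinates
  rw [hfacW]
  change ε / 2 ≤ (∫ U, m U.negReflect * m U ∂(wilsonMeasure (d := 4) (L := 2 * L + 1) r.ρ β)) -
    (∫ U, m U.negReflect ∂(wilsonMeasure (d := 4) (L := 2 * L + 1) r.ρ β)) *
      (∫ U, m U ∂(wilsonMeasure (d := 4) (L := 2 * L + 1) r.ρ β))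
  rw [hinvm, ← sq]
  exact bare_floor_arith hε hX0 hQ hcs hdd'

/-- **Along a unit map** (the asymptotic currency of `Q2_floor_of_bareFloor_chiral`): with the cube family, the
lattice-support clause and (RBLΔ) of the clause-(i) package, a floor `ε ≤ Q2_{β,L,aβ}(θv, v)` for `β ≥ β₅`,
`Λ₅ ≤ aβ·L` forces the bare mirror floor `ε/2 ≤ Cov_T(Ṽ_v∘Θ₀, Ṽ_v)` for `β ≥ max β₅ 0`, `Λ₅ ≤ aβ·L`. [folklore] -/
theorem bareFloors_of_Q2_floors (a : ℝ → ℝ) (ha₀ : ∀ β, 0 < a β)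
    (v : 𝓢(EuclideanSpace ℝ (Fin 4), ℝ)) {ε : ℝ} (hε : 0 < ε) {β₅ Λ₅ : ℝ}
    (c : ℝ → (Fin 4 → ℤ)) (b : ℝ → ℕ) (p' : ℝ → ℝ)
    (hgeom : ∀ β, β₅ ≤ β → 1 ≤ c β 0 ∧ ∀ j : Fin 4, (|((c β j : ℤ) : ℝ)| + (b β : ℝ) + 3) * a β ≤ Λ₅)
    (hsupp : ∀ β, β₅ ≤ β → ∀ x : Fin 4 → ℤ, v (a β • siteToE x) ≠ 0 →
      x ∈ cubeSites (c β) (b β) ∧ 2 ≤ depth (c β) (b β) x)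
    (hΔ : ∀ β, β₅ ≤ β → ∀ ζ,
      |kerE G r β (c β) (b β) ζ (fun V => ∑ x ∈ cubeSites (c β) (b β), v (a β • siteToE x) *
          ∑ q : {q : Fin 4 × Fin 4 // q.1 < q.2}, plane G r q.1 (if q.1.1 = 0 then x - Pi.single 0 1 else x) V) -
        kerE G r β (c β) (b β) ζ (fun V => ∑ y ∈ cubeSites (c β) (b β), v (a β • siteToE y) * dens G r y V) -
        p' β| ≤ Real.sqrt ε / 2)
    (hQ : ∀ β, β₅ ≤ β → ∀ L : ℕ, Λ₅ ≤ a β * L → ε ≤ Q2 G r β L (a β) (thetaTest 4 v) v) :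
    ∀ β, max β₅ 0 ≤ β → ∀ L : ℕ, Λ₅ ≤ a β * L →
      ε / 2 ≤ torusE G r β L (fun V =>
          (∑ y ∈ cubeSites (c β) (b β), v (a β • siteToE y) * dens G r y (cfgReflect V)) *
            ∑ y ∈ cubeSites (c β) (b β), v (a β • siteToE y) * dens G r y V) -
        torusE G r β L (fun V => ∑ y ∈ cubeSites (c β) (b β), v (a β • siteToE y) * dens G r y (cfgReflect V)) *
          torusE G r β L (fun V => ∑ y ∈ cubeSites (c β) (b β), v (a β • siteToE y) * dens G r y V) := by
  intro β hβ L hL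
  have hβ₅ : β₅ ≤ β := le_trans (le_max_left _ _) hβ
  have hβ0 : 0 ≤ β := le_trans (le_max_right _ _) hβ
  obtain ⟨hc0, hsize⟩ := hgeom β hβ₅
  obtain ⟨hcL, hc⟩ := torusFit_of_geom (ha₀ β) hsize hL
  exact bareFloor_of_Q2_floor G r hβ0 (c β) (b β) L hc0 hcL hc (a β) v (hsupp β hβ₅) hε (hΔ β hβ₅) (hQ β hβ₅ L hL)

end Converse

end Summit.QuantumFields.YangMills.Cruxes.NT.MarkovMirror

end
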